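import Summits.QuantumFields.QCD.Theorems.GapBuysCauchyRateRotationRestorationOfPlanarWard
import Summits.QuantumFields.QCD.Theorems.GapBuysCauchyRateRotationRestorationOnePointFactorisation
import Summits.QuantumFields.QCD.Theorems.GapBuysCauchyRateRotationRestorationOnePointInvariance
import HarnessLib

/-!
# `RotationRestoration` reduced to planar Ward restoration on separated tensors of DEGREE `n ≥ 2`

Crux `RotationRestoration` (item stmt-QuantumFields-8840; decl
`Summit.QuantumFields.QCD.Theses.GapBuysCauchyRate.RotationRestoration`, shared verbatim — and definitionally —
with `FourMirrorsWardE1.RotationRestoration` (primary) and `DiagonalSpine.RotationRestoration`), line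
`registered` (skeleton `Cruxes/RotationRestoration/Lines/birth.lean`, reshape r2 by the line lead).

Sequel of `GapBuysCauchyRateRotationRestorationOfPlanarWard` (`RotationRestoration_of_planarWard :
PlanarWardOnSeparatedTensors → RotationRestoration`, p152334).  Reshape r2 slices the one remaining physics
hypothesis by degree, and the degrees `0` and `1` are SOFT:
* `n = 0`: `linActMulti` is the identity on `𝓢((Fin 0 → ℝ⁴), ℂ)` (`LatticeInvariancePassesToLimit.linActMulti_fin_zero`);
* `n = 1`: the lattice one-point function factorises as `w_k(σ) · a_k⁴ ∑_{x ∈ box_k} f(a_k x)` by torus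
  translation covariance (`stub_onePointFactorisation`, p153035), the Riemann sums converge and the tie
  forces `w_k → w`, so every tied `S 1 σ` is `w · ∫` on compactly supported real tensors and is invariant under
  EVERY linear isometry (`stub_onePointInvariance`, p153439).

Hence (this file, sorry-free, CONDITIONAL):
* `planarWard_of_twoLe` — planar Ward restoration on separated tensors follows from its restriction to degrees
  `n ≥ 2` (the registered stub `stub_planarWardOnSeparatedTensorsTwoLe` of the skeleton, stated expanded);
* `RotationRestoration_of_planarWardTwoLe` (the `GapBuysCauchyRate` copy), `…_primary` (`FourMirrorsWardE1`),
  `…_diagonalSpine` — the crux is now EQUIVALENT to planar `SO(2)₀₁`-invariance of tied limits on separated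
  real tensors of degree `≥ 2` (the converse is trivial).

What remains open is exactly the physics the route header names: the `k`-uniform control of the
hypercubic-to-`O(4)` defect of the lattice rotation Ward identity (dimension-6 insertions of the
Caracciolo–Curci–Menotti–Pelissetto lattice energy–momentum tensor) on separated smearings of degree `≥ 2`.
-/

noncomputable section

namespace Summit.QuantumFields.QCD.Cruxes.RotationRestoration.Birth

open scoped BigOperators Topology SchwartzMap
open Filter
open Literature.MathematicalPhysics.QuantumLattice Literature.MathematicalPhysics.AQFT
  Literature.MathematicalPhysics.QuantumFieldTheory
open Literature.Probability.LatticeModels (box)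
open Summit.QuantumFields.QCD.Theses.GapBuysCauchyRate (RotationRestoration)

/-- **Planar Ward restoration on separated tensors from its degree-`≥ 2` slice.**  The hypothesis is the
registered stub `stub_planarWardOnSeparatedTensorsTwoLe` of the skeleton (S2 with the guard `2 ≤ n`); degree
`0` is the identity action, degree `1` is `stub_onePointInvariance` fed with `stub_onePointFactorisation`. -/
theorem planarWard_of_twoLe
    (h : ∀ (Nf : ℕ) (sch : QCDScheme Nf), sch.HasAsymptoticScaling →
      (∀ fl : Fin Nf, ∀ᶠ k in atTop, -1 < sch.mq fl k) →
        (∃ Δ : ℝ, 0 < Δ ∧ sch.HasLatticeMassGap Δ) →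
          ∀ S : LabelledSchwingerFamily (QCDField Nf) (EuclideanSpace ℝ (Fin 4)), IsLatticeLimit sch S →
            ∀ n : ℕ, 2 ≤ n → ∀ (σ : Fin n → QCDField Nf)
              (R : EuclideanSpace ℝ (Fin 4) ≃ₗᵢ[ℝ] EuclideanSpace ℝ (Fin 4)), IsPlanar R →
              ∀ f : Fin n → 𝓢(EuclideanSpace ℝ (Fin 4), ℝ), IsSeparated f →
                ∀ F : 𝓢((Fin n → EuclideanSpace ℝ (Fin 4)), ℂ), IsTensorOf F (fun i => ofRealTest (f i)) →
                  S n σ (linActMulti R F) = S n σ F) :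
    PlanarWardOnSeparatedTensors := by
  intro Nf sch hAF hbr hgap S hlim n σ R hR f hf F hF
  rcases n with _ | _ | n
  · rw [LatticeInvariancePassesToLimit.linActMulti_fin_zero]
  · exact stub_onePointInvariance Nf sch S hlim (fun k τ => stub_onePointFactorisation Nf sch k τ) σ R f hf
      F hF
  · exact h Nf sch hAF hbr hgap S hlim (n + 2) (by omega) σ R hR f hf F hF

/-- **`RotationRestoration` (the `GapBuysCauchyRate` copy) from planar Ward restoration in degrees `≥ 2`
alone** — CONDITIONAL on the registered stub `stub_planarWardOnSeparatedTensorsTwoLe` (the crux's physics);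
everything else (even-permutation covariance, its passage to tied limits, the spinor intertwiners, totality,
Givens generation, the degree-`0`/`1` slices) is landed. -/
theorem RotationRestoration_of_planarWardTwoLe
    (h : ∀ (Nf : ℕ) (sch : QCDScheme Nf), sch.HasAsymptoticScaling →
      (∀ fl : Fin Nf, ∀ᶠ k in atTop, -1 < sch.mq fl k) →
        (∃ Δ : ℝ, 0 < Δ ∧ sch.HasLatticeMassGap Δ) →
          ∀ S : LabelledSchwingerFamily (QCDField Nf) (EuclideanSpace ℝ (Fin 4)), IsLatticeLimit sch S →
            ∀ n : ℕ, 2 ≤ n → ∀ (σ : Fin n → QCDField Nf)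
              (R : EuclideanSpace ℝ (Fin 4) ≃ₗᵢ[ℝ] EuclideanSpace ℝ (Fin 4)), IsPlanar R →
              ∀ f : Fin n → 𝓢(EuclideanSpace ℝ (Fin 4), ℝ), IsSeparated f →
                ∀ F : 𝓢((Fin n → EuclideanSpace ℝ (Fin 4)), ℂ), IsTensorOf F (fun i => ofRealTest (f i)) →
                  S n σ (linActMulti R F) = S n σ F) :
    RotationRestoration :=
  RotationRestoration_of_planarWard (planarWard_of_twoLe h)

/-- The same reduction for the PRIMARY copy `FourMirrorsWardE1.RotationRestoration` (definitionally equal). -/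
theorem RotationRestoration_of_planarWardTwoLe_primary
    (h : ∀ (Nf : ℕ) (sch : QCDScheme Nf), sch.HasAsymptoticScaling →
      (∀ fl : Fin Nf, ∀ᶠ k in atTop, -1 < sch.mq fl k) →
        (∃ Δ : ℝ, 0 < Δ ∧ sch.HasLatticeMassGap Δ) →
          ∀ S : LabelledSchwingerFamily (QCDField Nf) (EuclideanSpace ℝ (Fin 4)), IsLatticeLimit sch S →
            ∀ n : ℕ, 2 ≤ n → ∀ (σ : Fin n → QCDField Nf)
              (R : EuclideanSpace ℝ (Fin 4) ≃ₗᵢ[ℝ] EuclideanSpace ℝ (Fin 4)), IsPlanar R →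
              ∀ f : Fin n → 𝓢(EuclideanSpace ℝ (Fin 4), ℝ), IsSeparated f →
                ∀ F : 𝓢((Fin n → EuclideanSpace ℝ (Fin 4)), ℂ), IsTensorOf F (fun i => ofRealTest (f i)) →
                  S n σ (linActMulti R F) = S n σ F) :
    Summit.QuantumFields.QCD.Theses.FourMirrorsWardE1.RotationRestoration :=
  RotationRestoration_of_planarWard_primary (planarWard_of_twoLe h)

/-- The same reduction for the copy `DiagonalSpine.RotationRestoration` (definitionally equal). -/
theorem RotationRestoration_of_planarWardTwoLe_diagonalSpine
    (h : ∀ (Nf : ℕ) (sch : QCDScheme Nf), sch.HasAsymptoticScaling →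
      (∀ fl : Fin Nf, ∀ᶠ k in atTop, -1 < sch.mq fl k) →
        (∃ Δ : ℝ, 0 < Δ ∧ sch.HasLatticeMassGap Δ) →
          ∀ S : LabelledSchwingerFamily (QCDField Nf) (EuclideanSpace ℝ (Fin 4)), IsLatticeLimit sch S →
            ∀ n : ℕ, 2 ≤ n → ∀ (σ : Fin n → QCDField Nf)
              (R : EuclideanSpace ℝ (Fin 4) ≃ₗᵢ[ℝ] EuclideanSpace ℝ (Fin 4)), IsPlanar R →
              ∀ f : Fin n → 𝓢(EuclideanSpace ℝ (Fin 4), ℝ), IsSeparated f →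
                ∀ F : 𝓢((Fin n → EuclideanSpace ℝ (Fin 4)), ℂ), IsTensorOf F (fun i => ofRealTest (f i)) →
                  S n σ (linActMulti R F) = S n σ F) :
    Summit.QuantumFields.QCD.Theses.DiagonalSpine.RotationRestoration :=
  RotationRestoration_of_planarWard_diagonalSpine (planarWard_of_twoLe h)

end Summit.QuantumFields.QCD.Cruxes.RotationRestoration.Birth

end
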